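import Summits.Langlands.Langlands.Theses.SkinnerWilesDefectOne
import Literature.NumberTheory.Automorphic.BianchiOrdinaryClassicality

/-!
# Route `SkinnerWilesDefectOne`, crux `ProModularOrdinaryClassical` (stmt-Langlands-12921), line
# `top-degree-exact-control`: the glue stub `stub_dominantOfCentralAndSlotZero`

Registered stub of the checked skeleton `Cruxes/ProModularOrdinaryClassical/Lines/top-degree-exact-control.lean`
(lead copy, rev 3): DOMINANT diamond weight of a `ℚ̄_p`-point `x` of Hida's ordinary big Hecke algebra
`𝕋^{S,ord}(𝒰)` of `GL₂/F` (the Literature predicate `BigHeckeGLn.TameLevel.HasDominantDiamondWeight`,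
`Literature/NumberTheory/Automorphic/BianchiOrdinaryClassicality.lean`) from its two halves — the CENTRE of the
diamond character is `N_{F/ℚ}(u)^{2-k}` up to `N₁`-th powers (landed `stub_centralDiamondWeight`) and slot `0` is
killed by `N₂`-th powers (`stub_slotZeroDiamondWeight`, the ordering bit) — with `N = N₁ N₂`, because
`u ↦ ⟨u⟩_v` is multiplicative for `𝒰` maximal above `p` (`TameLevel.ordDiamondHom`) and
`diag(û, û) = diag(û, 1) · diag(1, û)`.  Pure algebra; declared in the skeleton's namespace
`Summit.Langlands.Langlands.Cruxes.ProModularOrdinaryClassical.TopDegreeExactControl` so that the landed theorem reads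
byte-identically to its registration (precedent: `Theorems/PhantomRMYoshidaResiduallyYoshidaLiftingDefs.lean`).

Conventions (tree): Hida levels are upper-triangular Iwahori (`iwahoriLevel`), `⟨u⟩_v = TameLevel.ordDiamond`,
`u : Fin 2 → 𝒪_vˣ` with slot `0` = first diagonal entry; `∏ᶠ` over the finite type of places above `p`.
References: KhareThorne2017 §6.3, §6.5 (diamond operators, `Λ`-structure); Hida1994AIF §1.
-/

noncomputable section

namespace Summit.Langlands.Langlands.Cruxes.ProModularOrdinaryClassical.TopDegreeExactControl

set_option linter.dupNamespace false

open Literature.NumberTheory.Automorphic Literature.NumberTheory.Automorphic.BigHeckeGLn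
open NumberField IsDedekindDomain
open scoped BigOperators

/-- For `𝒰` maximal above `p`, the diamond operators are multiplicative in `u`:
`⟨u u'⟩_v = ⟨u⟩_v ⟨u'⟩_v` in `𝕋^{S,ord}(𝒰)` (`TameLevel.ordDiamondHom`). [folklore] -/
theorem ordDiamond_mul {n : ℕ} {F : Type} [Field F] [NumberField F] {p : ℕ} [Fact p.Prime]
    (𝒰 : TameLevel n F p) (h𝒰 : 𝒰.IsMaximalAbove) {v : HeightOneSpectrum (𝓞 F)}
    (hv : (p : 𝓞 F) ∈ v.asIdeal) (u u' : Fin n → (v.adicCompletionIntegers F)ˣ) :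
    𝒰.ordDiamond hv (u * u') = 𝒰.ordDiamond hv u * 𝒰.ordDiamond hv u' := by
  rw [← TameLevel.ordDiamondHom_apply 𝒰 h𝒰 hv, ← TameLevel.ordDiamondHom_apply 𝒰 h𝒰 hv,
    ← TameLevel.ordDiamondHom_apply 𝒰 h𝒰 hv, map_mul]

/-- `diag(a, a) = diag(a, 1) · diag(1, a)` in `T₂` (`Fin 2 → M`). [folklore] -/
theorem pi_const_eq_mulSingle_zero_mul_mulSingle_one {M : Type*} [CommMonoid M] (a : M) :
    (fun _ : Fin 2 => a) = Pi.mulSingle (0 : Fin 2) a * Pi.mulSingle (1 : Fin 2) a := by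
  ext i
  fin_cases i <;> simp

/-- **Glue stub `stub_dominantOfCentralAndSlotZero`** (registered signature, verbatim; line
`top-degree-exact-control`, skeleton rev 3): dominant diamond weight from the centre character and the
finite order of slot `0`.  With `N = N₁ N₂`: `(∏ x⟨diag(û,û)⟩)^{N} = (N(u)^{2-k})^{N}` (from `N₁`),
`(∏ x⟨diag(û,1)⟩)^{N} = 1` (from `N₂`), and `∏ x⟨diag(û,û)⟩ = ∏ x⟨diag(û,1)⟩ · ∏ x⟨diag(1,û)⟩`
(multiplicativity of `⟨·⟩_v`, of `x` and of `∏ᶠ` over the finitely many places above `p`), whence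
`(∏ x⟨diag(1,û)⟩)^{N} = (N(u)^{2-k})^{N}`. [folklore] -/
theorem stub_dominantOfCentralAndSlotZero : ∀ (F : Type) [Field F] [NumberField F] (p : ℕ) [Fact p.Prime] (𝒰 : Literature.NumberTheory.Automorphic.BigHeckeGLn.TameLevel 2 F p) (x : Literature.NumberTheory.Automorphic.OrdinaryHeckeAlgebraGLn 𝒰 →+* PadicAlgCl p) (k : ℕ), 𝒰.IsMaximalAbove → (∃ N : ℕ, 0 < N ∧ ∀ (u : NumberField.RingOfIntegers F) (û : ∀ v : IsDedekindDomain.HeightOneSpectrum (NumberField.RingOfIntegers F), (p : NumberField.RingOfIntegers F) ∈ v.asIdeal → (v.adicCompletionIntegers F)ˣ), (∀ (v : IsDedekindDomain.HeightOneSpectrum (NumberField.RingOfIntegers F)) (hv : (p : NumberField.RingOfIntegers F) ∈ v.asIdeal), ((û v hv : v.adicCompletionIntegers F) : v.adicCompletion F) = algebraMap F (v.adicCompletion F) (u : F)) → (∏ᶠ v : {v : IsDedekindDomain.HeightOneSpectrum (NumberField.RingOfIntegers F) // (p : NumberField.RingOfIntegers F) ∈ v.asIdeal}, x (𝒰.ordDiamond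 v.2 (fun _ : Fin 2 => û v.1 v.2))) ^ N = (((Algebra.norm ℤ u : ℤ) : PadicAlgCl p) ^ (2 - (k : ℤ))) ^ N) → (∃ N : ℕ, 0 < N ∧ ∀ (u : NumberField.RingOfIntegers F) (û : ∀ v : IsDedekindDomain.HeightOneSpectrum (NumberField.RingOfIntegers F), (p : NumberField.RingOfIntegers F) ∈ v.asIdeal → (v.adicCompletionIntegers F)ˣ), (∀ (v : IsDedekindDomain.HeightOneSpectrum (NumberField.RingOfIntegers F)) (hv : (p : NumberField.RingOfIntegers F) ∈ v.asIdeal), ((û v hv : v.adicCompletionIntegers F) : v.adicCompletion F) = algebraMap F (v.adicCompletion F) (u : F)) → (∏ᶠ v : {v : IsDedekindDomain.HeightOneSpectrum (NumberField.RingOfIntegers F) // (p : NumberField.RingOfIntegers F) ∈ v.asIdeal}, x (𝒰.ordDiamond v.2 (Pi.mulSingle (0 : Fin 2) (û v.1 v.2)))) ^ N = 1) → 𝒰.HasDominantDiamondWeight x k := by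
  intro F _ _ p _ 𝒰 x k h𝒰 hcen hslot
  obtain ⟨N₁, hN₁, h₁⟩ := hcen
  obtain ⟨N₂, hN₂, h₂⟩ := hslot
  refine ⟨N₁ * N₂, Nat.mul_pos hN₁ hN₂, fun u û hû => ?_⟩
  haveI : Finite {v : HeightOneSpectrum (𝓞 F) // (p : 𝓞 F) ∈ v.asIdeal} :=
    (BigHeckeGLn.finite_setOf_natCast_mem_asIdeal F p).to_subtype
  -- the three products over the places above `p`
  set c : PadicAlgCl p := ∏ᶠ v : {v : HeightOneSpectrum (𝓞 F) // (p : 𝓞 F) ∈ v.asIdeal},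
    x (𝒰.ordDiamond v.2 (fun _ : Fin 2 => û v.1 v.2)) with hc
  set s₀ : PadicAlgCl p := ∏ᶠ v : {v : HeightOneSpectrum (𝓞 F) // (p : 𝓞 F) ∈ v.asIdeal},
    x (𝒰.ordDiamond v.2 (Pi.mulSingle (0 : Fin 2) (û v.1 v.2))) with hs₀
  set s₁ : PadicAlgCl p := ∏ᶠ v : {v : HeightOneSpectrum (𝓞 F) // (p : 𝓞 F) ∈ v.asIdeal},
    x (𝒰.ordDiamond v.2 (Pi.mulSingle (1 : Fin 2) (û v.1 v.2))) with hs₁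
  have hcs : c = s₀ * s₁ := by
    rw [hc, hs₀, hs₁, ← finprod_mul_distrib (Set.toFinite _) (Set.toFinite _)]
    refine finprod_congr fun v => ?_
    rw [← map_mul, ← ordDiamond_mul 𝒰 h𝒰, ← pi_const_eq_mulSingle_zero_mul_mulSingle_one]
  have hcN : c ^ (N₁ * N₂) = (((Algebra.norm ℤ u : ℤ) : PadicAlgCl p) ^ (2 - (k : ℤ))) ^ (N₁ * N₂) := by
    rw [pow_mul, pow_mul, h₁ u û hû]
  have hs₀N : s₀ ^ (N₁ * N₂) = 1 := by
    rw [mul_comm, pow_mul, h₂ u û hû, one_pow]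
  refine ⟨?_, hs₀N⟩
  rw [← hcN, hcs, mul_pow, hs₀N, one_mul]

end Summit.Langlands.Langlands.Cruxes.ProModularOrdinaryClassical.TopDegreeExactControl

end
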